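import Summits.CriticalPhenomena.PercolationContinuityZ3.Theorems.PercNearOneGluingNoHeavyLowerTailSahiCTCRtThreeLocalWindow
import HarnessLib

/-!
# `NoHeavyLowerTail` (crux stmt-CriticalPhenomena-4575), P3 lane: TRANSPORT OF THE LOCAL QUANTITIES ALONG AN INJECTION —
# atom sums and small-pair sums on `W.map φ` are those of the pulled-back families on `W`

Support file (seat `prim-l12-p3`, gen 50; `--supports stmt-CriticalPhenomena-4575`).  Memo
`run/shared/lean/prim/prim-l12/FROM-prim-l12-p3-g50-KLEITMAN-BULK.md` §6.

`…LocalWindow.coeff_ind_Rt_three_nonneg_of_local` reduces ROW 0 of `R_3 ∈ ℕ[s]` to an inequality on every 4-subset `Q ⊆ V` involving only the traces of the two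
families on `Q`.  To decide such an inequality once and for all on a concrete 4-element type one transports it along a bijection `Fin 4 ≃ Q`; this file
provides the transport lemmas for an arbitrary injection `φ : β ↪ α` and `W : Finset β`, with the PULLED-BACK family written without a new definition as
`W.powerset.filter (fun T => T.map φ ∈ 𝒳)`:
* `sum_powerset_map`, `atomΩ_map`, `ιq_map` (reindexing, invariance of the atom weight and of the indicators);
* `atomSum_map` : `atomSum w 𝒳 𝒵 (W.map φ) = atomSum w 𝒳_φ 𝒵_φ W`;
* `ιq_smallXo_map` (and `Zo`, `N`, `Y`) : the four small classes pull back (`[Fintype β]`, `W = univ`);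
* `localPairs_map` : the localised small-pair double sum on `univ.map φ` equals the one of the pulled-back families on `univ`.
No new definitions; nothing is asserted about the crux.
-/

noncomputable section

open scoped Classical

namespace Summit.CriticalPhenomena.PercolationContinuityZ3.Theorems.SahiCTCForms

open Finset

variable {α β : Type*} [DecidableEq α] [DecidableEq β]

omit [DecidableEq α] [DecidableEq β] in
/-- Reindexing a sum over the subsets of an image: `Σ_{S ⊆ W.map φ} g S = Σ_{T ⊆ W} g (T.map φ)`. [this work] -/
theorem sum_powerset_map (φ : β ↪ α) (W : Finset β) (g : Finset α → ℚ) :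
    ∑ S ∈ (W.map φ).powerset, g S = ∑ T ∈ W.powerset, g (T.map φ) := by
  symm
  refine sum_bij (fun T _ => T.map φ) (fun T hT => ?_) (fun T₁ h₁ T₂ h₂ h => ?_) (fun S hS => ?_) (fun T hT => rfl)
  · exact mem_powerset.2 (map_subset_map.2 (mem_powerset.1 hT))
  · exact (map_inj (f := φ)).1 h
  · obtain ⟨T, hTW, rfl⟩ := subset_map_iff.1 (mem_powerset.1 hS)
    exact ⟨T, mem_powerset.2 hTW, rfl⟩

section Weights
variable (wJ wX wOx wOz wOO : ℕ → ℕ → ℕ → ℚ)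

/-- The atom weight is invariant under an injection. [this work] -/
theorem atomΩ_map (φ : β ↪ α) (S : Finset β) (u : β) (S' : Finset β) (v : β) :
    atomΩ wJ wX wOx wOz wOO (S.map φ) (φ u) (S'.map φ) (φ v) = atomΩ wJ wX wOx wOz wOO S u S' v := by
  unfold atomΩ
  rw [← map_inter, ← Finset.map_sdiff, ← Finset.map_sdiff, card_map, card_map, card_map]
  simp only [mem_map', φ.injective.eq_iff]

/-- The indicator of the pulled-back family: for `T ⊆ W`, `[T.map φ ∈ 𝒳] = [T ∈ 𝒳_φ]`. [this work] -/
theorem ιq_map (φ : β ↪ α) (F : Finset (Finset α)) {W T : Finset β} (hT : T ⊆ W) :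
    ιq F (T.map φ) = ιq (W.powerset.filter fun T => T.map φ ∈ F) T := by
  unfold ιq
  simp only [mem_filter, mem_powerset, hT, true_and]

/-- **TRANSPORT OF THE ATOM SUM**: `atomSum w 𝒳 𝒵 (W.map φ) = atomSum w 𝒳_φ 𝒵_φ W` with `𝒳_φ = {T ⊆ W : T.map φ ∈ 𝒳}`. [this work] -/
theorem atomSum_map (φ : β ↪ α) (F G : Finset (Finset α)) (W : Finset β) :
    atomSum wJ wX wOx wOz wOO F G (W.map φ) =
      atomSum wJ wX wOx wOz wOO (W.powerset.filter fun T => T.map φ ∈ F) (W.powerset.filter fun T => T.map φ ∈ G) W := by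
  unfold atomSum
  rw [sum_powerset_map]
  refine sum_congr rfl fun A hA => ?_
  have hAW : A ⊆ W := mem_powerset.1 hA
  rw [← Finset.map_sdiff, sum_map]
  refine sum_congr rfl fun u hu => ?_
  have huW : u ∈ W := (mem_sdiff.1 hu).1
  rw [sum_powerset_map]
  refine sum_congr rfl fun B hB => ?_
  have hBW : B ⊆ W := mem_powerset.1 hB
  rw [← Finset.map_sdiff, sum_map]
  refine sum_congr rfl fun v hv => ?_
  have hvW : v ∈ W := (mem_sdiff.1 hv).1
  rw [← map_insert, ← map_insert, atomΩ_map, ιq_map φ F (insert_subset huW hAW), ιq_map φ F hAW, ιq_map φ G (insert_subset hvW hBW),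
    ιq_map φ G hBW]

end Weights

/-! ### The four small classes pull back (whole type `β`, `W = univ`) -/

section Small
variable [Fintype α] [Fintype β] (φ : β ↪ α) (F G : Finset (Finset α))

/-- `[P.map φ ∈ X₂ᵒ(𝒳,𝒵)] = [P ∈ X₂ᵒ(𝒳_φ,𝒵_φ)]`. [this work] -/
theorem ιq_smallXo_map (P : Finset β) :
    ιq (smallXo F G) (P.map φ) =
      ιq (smallXo ((univ : Finset β).powerset.filter fun T => T.map φ ∈ F) ((univ : Finset β).powerset.filter fun T => T.map φ ∈ G)) P := by
  unfold ιq smallXo bySize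
  simp only [mem_filter, mem_powerset, subset_univ, true_and, card_map]

/-- `[P.map φ ∈ Z₂ᵒ(𝒳,𝒵)] = [P ∈ Z₂ᵒ(𝒳_φ,𝒵_φ)]`. [this work] -/
theorem ιq_smallZo_map (P : Finset β) :
    ιq (smallZo F G) (P.map φ) =
      ιq (smallZo ((univ : Finset β).powerset.filter fun T => T.map φ ∈ F) ((univ : Finset β).powerset.filter fun T => T.map φ ∈ G)) P := by
  unfold ιq smallZo bySize
  simp only [mem_filter, mem_powerset, subset_univ, true_and, card_map]

/-- `[P.map φ ∈ N₂(𝒳,𝒵)] = [P ∈ N₂(𝒳_φ,𝒵_φ)]`. [this work] -/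
theorem ιq_smallN_map (P : Finset β) :
    ιq (smallN F G) (P.map φ) =
      ιq (smallN ((univ : Finset β).powerset.filter fun T => T.map φ ∈ F) ((univ : Finset β).powerset.filter fun T => T.map φ ∈ G)) P := by
  unfold ιq smallN bySize
  simp only [mem_filter, mem_powerset, subset_univ, true_and, card_map]

/-- `[P.map φ ∈ Y₂(𝒳,𝒵)] = [P ∈ Y₂(𝒳_φ,𝒵_φ)]`. [this work] -/
theorem ιq_smallY_map (P : Finset β) :
    ιq (smallY F G) (P.map φ) =
      ιq (smallY ((univ : Finset β).powerset.filter fun T => T.map φ ∈ F) ((univ : Finset β).powerset.filter fun T => T.map φ ∈ G)) P := by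
  unfold ιq smallY bySize
  simp only [mem_filter, mem_powerset, subset_univ, true_and, card_map]

/-- **TRANSPORT OF THE LOCALISED SMALL PAIRS**: the double sum over the subsets of `univ.map φ` with coefficients depending on `#(P ∪ P')` and on
`[P ∩ P' = ∅]` equals the one of the pulled-back families over the subsets of `univ`. [this work] -/
theorem localPairs_map (c : ℕ → ℚ) :
    ∑ P ∈ ((univ : Finset β).map φ).powerset, ∑ P' ∈ ((univ : Finset β).map φ).powerset,
        (ιq (smallXo F G) P * ιq (smallZo F G) P' * (if Disjoint P P' then 1 else 0) * c #(P ∪ P')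
          - ιq (smallN F G) P * ιq (smallY F G) P' * (if Disjoint P P' then 1 else 0) * c #(P ∪ P')) =
      ∑ P ∈ (univ : Finset β).powerset, ∑ P' ∈ (univ : Finset β).powerset,
        (ιq (smallXo ((univ : Finset β).powerset.filter fun T => T.map φ ∈ F) ((univ : Finset β).powerset.filter fun T => T.map φ ∈ G)) P *
            ιq (smallZo ((univ : Finset β).powerset.filter fun T => T.map φ ∈ F) ((univ : Finset β).powerset.filter fun T => T.map φ ∈ G)) P' *
            (if Disjoint P P' then 1 else 0) * c #(P ∪ P')
          - ιq (smallN ((univ : Finset β).powerset.filter fun T => T.map φ ∈ F) ((univ : Finset β).powerset.filter fun T => T.map φ ∈ G)) P *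
            ιq (smallY ((univ : Finset β).powerset.filter fun T => T.map φ ∈ F) ((univ : Finset β).powerset.filter fun T => T.map φ ∈ G)) P' *
            (if Disjoint P P' then 1 else 0) * c #(P ∪ P')) := by
  rw [sum_powerset_map]
  refine sum_congr rfl fun P _ => ?_
  rw [sum_powerset_map]
  refine sum_congr rfl fun P' _ => ?_
  have hd : (if Disjoint (P.map φ) (P'.map φ) then (1 : ℚ) else 0) = (if Disjoint P P' then 1 else 0) := by
    by_cases h : Disjoint P P'
    · rw [if_pos h, if_pos ((disjoint_map φ).2 h)]
    · rw [if_neg h, if_neg (fun h' => h ((disjoint_map φ).1 h'))]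
  rw [ιq_smallXo_map, ιq_smallZo_map, ιq_smallN_map, ιq_smallY_map, ← map_union, card_map, hd]

end Small

end Summit.CriticalPhenomena.PercolationContinuityZ3.Theorems.SahiCTCForms
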